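import Summits.QuantumFields.YangMills.Theorems.VirialFluxGapAnchorChartSmooth
import Summits.QuantumFields.YangMills.Theorems.VirialFluxGapConjSliceFirstVariation
import Summits.QuantumFields.YangMills.Theorems.UnitScaleTiltFluctuationComparisonRegPrFibreLocalInverse
import Summits.QuantumFields.BalabanUV.InfraRed.StrongCouplingSphereCalculus
import Literature.MathematicalPhysics.QuantumFieldTheory.Federbush1986.PureAveragesSU2Lemma12
import HarnessLib

/-!
# Two EXPLICIT rotations in `SU(2)`: axis alignment and the half-angle azimuth — the algebra of the two-anchor covering theorem
# (layer (B2), item (c) covering ∕ `hfloor`, of the DIRECT Laplace road to ⟨stmt-QuantumFields-24204⟩ `VirialFluxGap.SharpTwistedLaplace`)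

Helper module (free-hands work of width seat ym-line-sfw-p2-w2 g50, cell ym-idea-1; `--supports 24204`), in the letters of
✓`VirialFluxGapAnchorSliceAlgebra` (w3 g57): pure units `n = ιω`, the residual `SU(2)` acting by conjugation `u ↦ κ u κ*`.
* §0 bookkeeping (`‖κ u κ* − u‖ ≤ 2‖κ − 1‖`, `1 − Re w = ‖w − 1‖²/2`, `|⟪w, x⟫| ≤ ‖w − 1‖‖x‖` for pure `x`);
* §1 ★ AXIS ALIGNMENT `conj_alignAxis`: for pure units `m, n` with `‖m − n‖ < 1`, `κ₁ = ρ/‖ρ‖`, `ρ = 1 − n m`, is a unit with `κ₁ m κ₁* = n`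
  (`ρ m = m + n = n ρ`) and `‖κ₁ − 1‖ ≤ 2‖m − n‖`; ★ `conj_seam_normalForm`: a unit `p` within `δ ≤ 1/4` of `ιω` is conjugated, by a unit
  `κ₁` with `‖κ₁ − 1‖ ≤ 4δ`, EXACTLY onto the seam slice: `κ₁ p κ₁* = Re p + ‖Im p‖·ιω = e^{ι(tω)}·ιω`, `sin t = −Re p`, `|t| < π/2`;
* §2 ★ HALF-ANGLE `halfAngle_sq`: for a unit `g` with `‖g − 1‖ < 1`, `κ = (1 + g)/‖1 + g‖` is a unit with `κ² = g`, `‖κ − 1‖ ≤ 2‖g − 1‖`;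
  ★ AZIMUTH `conj_azimuth_normalForm`: for a unit `w` with `‖w − 1‖ ≤ 1/4`, writing `w = w₀ + w_n n + w_⊥`, the half-angle root `κ₂ ∈ T_n` of
  `g = (w₀ − w_n n)/√(w₀² + w_n²)` satisfies `κ₂ w κ₂ = √(w₀² + w_n²) + w_⊥` (NO `n`-component, real part `≥ Re w`), `‖κ₂ − 1‖ ≤ 4‖w − 1‖`.
The covering theorem itself (both anchors at once, and its `SU(2)` form with `seamSlice`/`linkSlice`) is the sequel `…AnchorSliceCovering`.
Everything here is PROVED; no definitions, no named facts (namespace `Summit.QuantumFields.YangMills.Theorems.VirialFluxGap.AnchorSlice`).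

HONEST FRAMING: quaternion algebra; ⟨24204⟩, ⟨24319⟩, ⟨22884⟩ and every rung stay OPEN; the Yang–Mills mass gap (Clay) is NOT touched; no summit is
proved by a line.

## References
* G. E. Bredon, *Introduction to Compact Transformation Groups* (1972), Ch. II §§4–5 (tubes are neighbourhoods of the orbit). [Bredon1972]
-/

set_option autoImplicit false

noncomputable section

open scoped Quaternion RealInnerProductSpace
open NormedSpace
open Literature.MathematicalPhysics.QuantumFieldTheory hiding SU2
open Literature.MathematicalPhysics.QuantumLattice
open Literature.MathematicalPhysics.QuantumFieldTheory.Balaban1983to89.T4WilsonGaugeFlatDirection (su2Quat_injective)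
open Literature.MathematicalPhysics.QuantumFieldTheory.Balaban1983to89.T4WilsonLinkAffine (su2Quat_inv)
open Literature.MathematicalPhysics.QuantumFieldTheory.Balaban1983to89.T4HaarSU2ExpChart
open Literature.MathematicalPhysics.QuantumFieldTheory.Balaban1983to89.T4ExpWindowSmallField
open Literature.MathematicalPhysics.QuantumFieldTheory.Balaban1983to89.T4HaarSU2Translate (su2Quat_quatToSU2)
open Summit.QuantumFields.YangMills.Theorems.FemtoTransferGap
open Summit.QuantumFields.YangMills.Theorems.FemtoTransferGap.TT
open Summit.QuantumFields.YangMills.Theorems.FibreLocalInverse (star_mul_self_of_norm_eq_one self_mul_star_of_norm_eq_one)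
open Summit.QuantumFields.BalabanUV.InfraRed.StrongCouplingSphereCalculus (mul_self_of_re_eq_zero)
open Literature.MathematicalPhysics.QuantumFieldTheory.Federbush1986.SU2 (norm_im_le)
open Summit.QuantumFields.YangMills.Theorems.QuantitativeLaplace (quat_norm_im_eq_sqrt)

namespace Summit.QuantumFields.YangMills.Theorems.VirialFluxGap.AnchorSlice

/-! ## §0 Unit-quaternion bookkeeping -/

/-- Conjugation moves a point by at most twice the distance of the conjugator from `1`:
`‖κ u κ* − u‖ ≤ 2‖κ − 1‖` for units `κ, u`. [folklore] -/
theorem norm_conj_sub_self_le {κ u : ℍ} (hκ : ‖κ‖ = 1) (hu : ‖u‖ = 1) : ‖κ * u * star κ - u‖ ≤ 2 * ‖κ - 1‖ := by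
  have e : κ * u * star κ - u = (κ - 1) * u * star κ + u * (star κ - star 1) := by rw [star_one]; noncomm_ring
  rw [e]
  calc ‖(κ - 1) * u * star κ + u * (star κ - star 1)‖ ≤ ‖(κ - 1) * u * star κ‖ + ‖u * (star κ - star 1)‖ := norm_add_le _ _
    _ = 2 * ‖κ - 1‖ := by
        rw [norm_mul, norm_mul, norm_mul, norm_star, hκ, hu, ← star_sub, norm_star, mul_one, mul_one, one_mul]; ring

/-- `‖κ u κ* − q‖ ≤ ‖u − q‖ + 2‖κ − 1‖` for units `κ, u`. [folklore] -/
theorem norm_conj_sub_le {κ u : ℍ} (hκ : ‖κ‖ = 1) (hu : ‖u‖ = 1) (q : ℍ) : ‖κ * u * star κ - q‖ ≤ ‖u - q‖ + 2 * ‖κ - 1‖ := by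
  calc ‖κ * u * star κ - q‖ = ‖(κ * u * star κ - u) + (u - q)‖ := by rw [sub_add_sub_cancel]
    _ ≤ ‖κ * u * star κ - u‖ + ‖u - q‖ := norm_add_le _ _
    _ ≤ ‖u - q‖ + 2 * ‖κ - 1‖ := by linarith [norm_conj_sub_self_le hκ hu]

/-- For a unit `w`: `1 − Re w = ‖w − 1‖²/2`. [folklore] -/
theorem one_sub_re_eq {w : ℍ} (hw : ‖w‖ = 1) : 1 - w.re = ‖w - 1‖ ^ 2 / 2 := by
  rw [norm_sub_one_sq hw]; ring

/-- For a unit `w`: `|⟪w, n⟫| ≤ ‖w − 1‖` for any pure `n` with `‖n‖ ≤ 1`… we use the cruder `|⟪w, x⟫| ≤ ‖w − 1‖·‖x‖` for `x` pure. [folklore] -/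
theorem abs_inner_le_norm_sub_one_mul {w x : ℍ} (hx : x.re = 0) : |⟪w, x⟫| ≤ ‖w - 1‖ * ‖x‖ := by
  have h1 : ⟪(1 : ℍ), x⟫ = 0 := by rw [Quaternion.inner_def, one_mul, Quaternion.re_star, hx]
  have e : ⟪w, x⟫ = ⟪w - 1, x⟫ := by rw [inner_sub_left, h1, sub_zero]
  rw [e]; exact abs_real_inner_le_norm _ _

/-! ## §1 Axis alignment: rotating a pure unit `m` onto a pure unit `n` -/

/-- ★ **Axis alignment.**  For pure units `m, n` with `‖m − n‖ < 1`, `ρ = 1 − n m` is non-zero, the unit `κ₁ = ρ/‖ρ‖` conjugates `m` to `n`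
EXACTLY, and `‖κ₁ − 1‖ ≤ 2‖m − n‖`. [folklore] -/
theorem conj_alignAxis {m n : ℍ} (hm0 : m.re = 0) (hm1 : ‖m‖ = 1) (hn0 : n.re = 0) (hn1 : ‖n‖ = 1) (hmn : ‖m - n‖ < 1) :
    ‖(‖1 - n * m‖⁻¹ • (1 - n * m) : ℍ)‖ = 1 ∧
      (‖1 - n * m‖⁻¹ • (1 - n * m)) * m * star (‖1 - n * m‖⁻¹ • (1 - n * m)) = n ∧
      ‖‖1 - n * m‖⁻¹ • (1 - n * m) - 1‖ ≤ 2 * ‖m - n‖ := by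
  set d : ℍ := m - n with hd
  set ρ : ℍ := 1 - n * m with hρ
  have hnn := mul_self_of_re_eq_zero hn0 hn1
  have hmm := mul_self_of_re_eq_zero hm0 hm1
  have h2c : ((2 : ℝ) : ℍ) = 1 + 1 := by rw [show (2 : ℝ) = 1 + 1 by norm_num, Quaternion.coe_add, Quaternion.coe_one]
  have hρ2 : ρ = ((2 : ℝ) : ℍ) - n * d := by
    rw [h2c, hρ, hd, mul_sub, hnn]; noncomm_ring
  have hnd : ‖n * d‖ = ‖d‖ := by rw [norm_mul, hn1, one_mul]
  have hρlow : 2 - ‖d‖ ≤ ‖ρ‖ := by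
    have := norm_sub_norm_le ((2 : ℝ) : ℍ) (n * d)
    rw [← hρ2, hnd] at this
    have h2 : ‖((2 : ℝ) : ℍ)‖ = 2 := by rw [Quaternion.norm_coe]; norm_num
    linarith
  have hρpos : 0 < ‖ρ‖ := by linarith
  have hρne : ρ ≠ 0 := norm_pos_iff.mp hρpos
  -- the key identity `ρ m = n ρ`
  have hkey : ρ * m = n * ρ := by
    rw [hρ, sub_mul, one_mul, mul_assoc, hmm, mul_sub, mul_one, ← mul_assoc, hnn]; noncomm_ring
  refine ⟨?_, ?_, ?_⟩
  · rw [norm_smul, norm_inv, norm_norm, inv_mul_cancel₀ hρpos.ne']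
  · rw [Quaternion.star_smul, smul_mul_assoc, smul_mul_assoc, mul_smul_comm, smul_smul, hkey, mul_assoc, Quaternion.self_mul_star,
      Quaternion.normSq_eq_norm_mul_self, ← Quaternion.coe_mul_eq_smul]
    rw [show ((‖ρ‖⁻¹ * ‖ρ‖⁻¹ : ℝ) : ℍ) * (n * ((‖ρ‖ * ‖ρ‖ : ℝ) : ℍ)) = ((‖ρ‖⁻¹ * ‖ρ‖⁻¹ * (‖ρ‖ * ‖ρ‖) : ℝ) : ℍ) * n by
      rw [← Quaternion.coe_commutes (‖ρ‖ * ‖ρ‖) n, ← mul_assoc, ← Quaternion.coe_mul]]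
    rw [show ‖ρ‖⁻¹ * ‖ρ‖⁻¹ * (‖ρ‖ * ‖ρ‖) = 1 by field_simp, Quaternion.coe_one, one_mul]
  · -- `‖κ₁ − 1‖ ≤ 2‖d‖`
    have hρup : ‖ρ‖ ≤ 2 + ‖d‖ := by
      have := norm_sub_le ((2 : ℝ) : ℍ) (n * d)
      rw [← hρ2, hnd] at this
      have h2 : ‖((2 : ℝ) : ℍ)‖ = 2 := by rw [Quaternion.norm_coe]; norm_num
      linarith
    have hdiff : ‖ρ - (‖ρ‖ : ℍ)‖ ≤ 2 * ‖d‖ := by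
      have e : ρ - (‖ρ‖ : ℍ) = ((2 - ‖ρ‖ : ℝ) : ℍ) - n * d := by
        rw [hρ2, Quaternion.coe_sub]; abel
      rw [e]
      calc ‖((2 - ‖ρ‖ : ℝ) : ℍ) - n * d‖ ≤ ‖((2 - ‖ρ‖ : ℝ) : ℍ)‖ + ‖n * d‖ := norm_sub_le _ _
        _ = |2 - ‖ρ‖| + ‖d‖ := by rw [Quaternion.norm_coe, Real.norm_eq_abs, hnd]
        _ ≤ 2 * ‖d‖ := by
            have : |2 - ‖ρ‖| ≤ ‖d‖ := abs_le.mpr ⟨by linarith, by linarith⟩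
            linarith
    have e1 : ‖ρ‖⁻¹ • (‖ρ‖ : ℍ) = 1 := by
      rw [← Quaternion.coe_smul, smul_eq_mul, inv_mul_cancel₀ hρpos.ne', Quaternion.coe_one]
    have e2 : ‖ρ‖⁻¹ • ρ - 1 = ‖ρ‖⁻¹ • (ρ - (‖ρ‖ : ℍ)) := by
      rw [smul_sub ‖ρ‖⁻¹ ρ (‖ρ‖ : ℍ), e1]
    rw [e2, norm_smul, norm_inv, norm_norm]
    have hd1 : ‖d‖ < 1 := hmn
    calc ‖ρ‖⁻¹ * ‖ρ - (‖ρ‖ : ℍ)‖ ≤ ‖ρ‖⁻¹ * (2 * ‖d‖) := mul_le_mul_of_nonneg_left hdiff (inv_nonneg.mpr hρpos.le)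
      _ ≤ 1 * (2 * ‖d‖) := by
          refine mul_le_mul_of_nonneg_right ?_ (by positivity)
          rw [inv_le_comm₀ hρpos one_pos, inv_one]; linarith
      _ = 2 * ‖m - n‖ := by rw [one_mul]


/-- ★ **The seam anchor put on the seam slice.**  For a unit `p` within `δ ≤ 1/4` of the pure unit `n = ιω`: a unit `κ₁` with
`‖κ₁ − 1‖ ≤ 4δ` and a real `t` with `|t| < π/2`, `sin t = −Re p`, such that `κ₁ p κ₁* = e^{ι(tω)}·ιω` EXACTLY. [folklore] -/
theorem conj_seam_normalForm {ω : EuclideanSpace ℝ (Fin 3)} (hω : ‖ω‖ = 1) {p : ℍ} (hp : ‖p‖ = 1) {δ : ℝ} (hδ : δ ≤ 1 / 4)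
    (hpn : ‖p - imQuat ω‖ ≤ δ) :
    ∃ (κ : ℍ) (t : ℝ), ‖κ‖ = 1 ∧ κ * p * star κ = exp (imQuat (t • ω)) * imQuat ω ∧ |t| < Real.pi / 2 ∧ Real.sin t = -p.re ∧
      |p.re| ≤ δ ∧ ‖κ - 1‖ ≤ 4 * δ := by
  set n : ℍ := imQuat ω with hn
  have hn0 : n.re = 0 := imQuat_re ω
  have hn1 : ‖n‖ = 1 := by rw [hn, norm_imQuat, hω]
  have hδ0 : 0 ≤ δ := (norm_nonneg _).trans hpn
  -- the real part and the imaginary part of `p`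
  have hre : |p.re| ≤ δ := by
    have h := sq_norm_eq_sum_sq (p - n)
    have h' : (p - n).re = p.re := by simp [hn0]
    have : p.re ^ 2 ≤ ‖p - n‖ ^ 2 := by rw [h, h']; nlinarith
    have := (pow_le_pow_iff_left₀ (abs_nonneg _) (norm_nonneg _) two_ne_zero).mp ((sq_abs p.re).symm ▸ this)
    exact this.trans hpn
  have him : ‖p.im - n‖ ≤ δ := by
    have e : p.im - n = (p - n).im := by ext <;> simp [hn0]
    rw [e]; exact (norm_im_le _).trans hpn
  -- the axis `m = Im p/‖Im p‖`
  have himlow : 1 - δ ≤ ‖p.im‖ := by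
    have := norm_sub_norm_le n p.im
    rw [hn1, norm_sub_rev] at this; linarith
  have himpos : 0 < ‖p.im‖ := by linarith
  set m : ℍ := ‖p.im‖⁻¹ • p.im with hm
  have hm0 : m.re = 0 := by simp [hm]
  have hm1 : ‖m‖ = 1 := by rw [hm, norm_smul, norm_inv, norm_norm, inv_mul_cancel₀ himpos.ne']
  have hpim : p.im = ‖p.im‖ • m := by rw [hm, smul_smul, mul_inv_cancel₀ himpos.ne', one_smul]
  have hmn : ‖m - n‖ ≤ 2 * δ := by
    have e1 : m - p.im = (1 - ‖p.im‖) • m := by rw [sub_smul, one_smul, ← hpim]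
    have h1 : ‖m - p.im‖ ≤ δ := by
      rw [e1, norm_smul, hm1, mul_one, Real.norm_eq_abs]
      have hup : ‖p.im‖ ≤ 1 + δ := by
        have := norm_le_norm_add_norm_sub' p.im n  -- ‖p.im‖ ≤ ‖n‖ + ‖p.im - n‖
        rw [hn1] at this; linarith
      rw [abs_le]; constructor <;> linarith
    calc ‖m - n‖ = ‖(m - p.im) + (p.im - n)‖ := by rw [sub_add_sub_cancel]
      _ ≤ ‖m - p.im‖ + ‖p.im - n‖ := norm_add_le _ _
      _ ≤ 2 * δ := by linarith
  have hmn1 : ‖m - n‖ < 1 := by linarith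
  obtain ⟨hκ1, hκm, hκd⟩ := conj_alignAxis hm0 hm1 hn0 hn1 hmn1
  generalize hκdef : (‖1 - n * m‖⁻¹ • (1 - n * m) : ℍ) = κ at hκ1 hκm hκd
  -- the angle `t`
  have hre1 : -1 < p.re ∧ p.re < 1 := by
    have := abs_le.mp hre; constructor <;> linarith
  refine ⟨κ, -Real.arcsin p.re, hκ1, ?_, ?_, ?_, hre, by linarith [hκd]⟩
  · -- `κ p κ* = Re p + ‖Im p‖·n = e^{ι(tω)} n`
    have hpdec : p = (p.re : ℍ) + ‖p.im‖ • m := by rw [← hpim]; exact (Quaternion.re_add_im p).symm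
    have a1 : κ * (p.re : ℍ) * star κ = (p.re : ℍ) := by
      rw [← Quaternion.coe_commutes p.re κ, mul_assoc, self_mul_star_of_norm_eq_one hκ1, mul_one]
    have a2 : κ * (‖p.im‖ • m) * star κ = ‖p.im‖ • n := by rw [mul_smul_comm, smul_mul_assoc, hκm]
    have e1 : κ * p * star κ = (p.re : ℍ) + ‖p.im‖ • n := by
      calc κ * p * star κ = κ * ((p.re : ℍ) + ‖p.im‖ • m) * star κ := by rw [← hpdec]
        _ = (p.re : ℍ) + ‖p.im‖ • n := by rw [mul_add, add_mul, a1, a2]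
    rw [e1, exp_smul_mul_self hω, Real.sin_neg, neg_neg, Real.sin_arcsin hre1.1.le hre1.2.le, Real.cos_neg,
      Real.cos_arcsin, quat_norm_im_eq_sqrt hp]
  · rw [abs_neg, abs_lt]
    exact ⟨Real.neg_pi_div_two_lt_arcsin.mpr hre1.1, Real.arcsin_lt_pi_div_two.mpr hre1.2⟩
  · rw [Real.sin_neg, Real.sin_arcsin hre1.1.le hre1.2.le]

/-! ## §2 Azimuth: killing the `n`-component by a half-angle rotation in `T_n` -/

/-- For a unit `g`: `‖1 + g‖² = 2 + 2 Re g`. [folklore] -/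
theorem norm_one_add_sq_of_unit {g : ℍ} (hg : ‖g‖ = 1) : ‖1 + g‖ ^ 2 = 2 + 2 * g.re := by
  have h : ‖-g - 1‖ ^ 2 = 2 - 2 * (-g).re := norm_sub_one_sq (by rw [norm_neg, hg])
  rw [show -g - 1 = -(1 + g) by abel, norm_neg, Quaternion.re_neg] at h
  linarith

/-- ★ **Half-angle square root in `SU(2)`.**  For a unit `g` with `‖g − 1‖ < 1`, the unit `κ = (1 + g)/‖1 + g‖` satisfies `κ² = g` and
`‖κ − 1‖ ≤ 2‖g − 1‖`. [folklore] -/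
theorem halfAngle_sq {g : ℍ} (hg : ‖g‖ = 1) (hg1 : ‖g - 1‖ < 1) :
    ‖(‖1 + g‖⁻¹ • (1 + g) : ℍ)‖ = 1 ∧ (‖1 + g‖⁻¹ • (1 + g)) * (‖1 + g‖⁻¹ • (1 + g)) = g ∧
      ‖‖1 + g‖⁻¹ • (1 + g) - 1‖ ≤ 2 * ‖g - 1‖ := by
  set ρ : ℍ := 1 + g with hρ
  have h2c : ((2 : ℝ) : ℍ) = 1 + 1 := by rw [show (2 : ℝ) = 1 + 1 by norm_num, Quaternion.coe_add, Quaternion.coe_one]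
  have hρ2 : ρ = ((2 : ℝ) : ℍ) + (g - 1) := by rw [h2c, hρ]; abel
  have h2n : ‖((2 : ℝ) : ℍ)‖ = 2 := by rw [Quaternion.norm_coe]; norm_num
  have hρlow : 2 - ‖g - 1‖ ≤ ‖ρ‖ := by
    have := norm_sub_norm_le ((2 : ℝ) : ℍ) (-(g - 1))
    rw [sub_neg_eq_add, ← hρ2, norm_neg, h2n] at this; linarith
  have hρup : ‖ρ‖ ≤ 2 + ‖g - 1‖ := by
    have := norm_add_le ((2 : ℝ) : ℍ) (g - 1)
    rw [← hρ2, h2n] at this; exact this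
  have hρpos : 0 < ‖ρ‖ := by linarith
  have hsq : ρ * ρ = (‖ρ‖ ^ 2 : ℝ) • g := by
    have hgg : g * g = (2 * g.re) • g - 1 := by
      have e : star g = ((2 * g.re : ℝ) : ℍ) - g := by rw [← Quaternion.self_add_star' g]; abel
      have h4 := self_mul_star_of_norm_eq_one hg
      rw [e, mul_sub, ← Quaternion.coe_commutes, Quaternion.coe_mul_eq_smul] at h4
      rw [← h4]; abel
    rw [norm_one_add_sq_of_unit hg, hρ]
    have e : (1 + g) * (1 + g) = 1 + g + g + g * g := by noncomm_ring
    rw [e, hgg]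
    module
  refine ⟨?_, ?_, ?_⟩
  · rw [norm_smul, norm_inv, norm_norm, inv_mul_cancel₀ hρpos.ne']
  · rw [smul_mul_assoc, mul_smul_comm, smul_smul, hsq, smul_smul, show ‖ρ‖⁻¹ * ‖ρ‖⁻¹ * ‖ρ‖ ^ 2 = 1 by field_simp, one_smul]
  · have hdiff : ‖ρ - (‖ρ‖ : ℍ)‖ ≤ 2 * ‖g - 1‖ := by
      have e : ρ - (‖ρ‖ : ℍ) = ((2 - ‖ρ‖ : ℝ) : ℍ) + (g - 1) := by rw [hρ2, Quaternion.coe_sub]; abel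
      rw [e]
      calc ‖((2 - ‖ρ‖ : ℝ) : ℍ) + (g - 1)‖ ≤ ‖((2 - ‖ρ‖ : ℝ) : ℍ)‖ + ‖g - 1‖ := norm_add_le _ _
        _ = |2 - ‖ρ‖| + ‖g - 1‖ := by rw [Quaternion.norm_coe, Real.norm_eq_abs]
        _ ≤ 2 * ‖g - 1‖ := by
            have : |2 - ‖ρ‖| ≤ ‖g - 1‖ := abs_le.mpr ⟨by linarith, by linarith⟩
            linarith
    have e1 : ‖ρ‖⁻¹ • (‖ρ‖ : ℍ) = 1 := by
      rw [← Quaternion.coe_smul, smul_eq_mul, inv_mul_cancel₀ hρpos.ne', Quaternion.coe_one]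
    have e2 : ‖ρ‖⁻¹ • ρ - 1 = ‖ρ‖⁻¹ • (ρ - (‖ρ‖ : ℍ)) := by rw [smul_sub ‖ρ‖⁻¹ ρ (‖ρ‖ : ℍ), e1]
    rw [e2, norm_smul, norm_inv, norm_norm]
    calc ‖ρ‖⁻¹ * ‖ρ - (‖ρ‖ : ℍ)‖ ≤ ‖ρ‖⁻¹ * (2 * ‖g - 1‖) := mul_le_mul_of_nonneg_left hdiff (inv_nonneg.mpr hρpos.le)
      _ ≤ 1 * (2 * ‖g - 1‖) := by
          refine mul_le_mul_of_nonneg_right ?_ (by positivity)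
          rw [inv_le_comm₀ hρpos one_pos, inv_one]; linarith
      _ = 2 * ‖g - 1‖ := one_mul _


/-- `‖a + b·n‖² = a² + b²` for a pure unit `n` and real `a, b`. [folklore] -/
theorem norm_coe_add_smul_pure_sq {n : ℍ} (hn0 : n.re = 0) (hn1 : ‖n‖ = 1) (a b : ℝ) : ‖(a : ℍ) + b • n‖ ^ 2 = a ^ 2 + b ^ 2 := by
  have hns : n.imI ^ 2 + n.imJ ^ 2 + n.imK ^ 2 = 1 := by
    have := sq_norm_eq_sum_sq n; rw [hn1, hn0] at this; nlinarith [this]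
  rw [sq_norm_eq_sum_sq]
  simp only [Quaternion.re_add, Quaternion.re_coe, Quaternion.re_smul, hn0, smul_eq_mul, mul_zero, add_zero, Quaternion.imI_add,
    Quaternion.imI_coe, Quaternion.imI_smul, zero_add, Quaternion.imJ_add, Quaternion.imJ_coe, Quaternion.imJ_smul, Quaternion.imK_add,
    Quaternion.imK_coe, Quaternion.imK_smul]
  nlinarith [hns]

/-- If `κ` commutes with the pure unit `n` and `x` is pure and orthogonal to `n`, then `κ x = x κ*` (`n` anticommutes with `x`). [folklore] -/
theorem mul_perp_eq_perp_mul_star {κ n x : ℍ} (hn0 : n.re = 0) (hn1 : ‖n‖ = 1) (hκn : κ * n = n * κ) (hx0 : x.re = 0)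
    (hxn : ⟪x, n⟫ = 0) : κ * x = x * star κ := by
  have hdec := eq_re_add_inner_smul_of_commute hn0 hn1 hκn
  have hanti : n * x = -(x * n) := mul_eq_neg_mul_of_pure_orth hx0 hn0 hxn
  have hstar : star κ = (κ.re : ℍ) - ⟪κ, n⟫ • n := by
    conv_lhs => rw [hdec]
    rw [star_add, Quaternion.star_coe, Quaternion.star_smul, star_eq_neg_of_pure hn0, smul_neg, sub_eq_add_neg]
  rw [hstar]
  conv_lhs => rw [hdec]
  rw [add_mul, smul_mul_assoc, hanti, mul_sub, mul_smul_comm, ← Quaternion.coe_commutes κ.re x, smul_neg, sub_eq_add_neg]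

/-- `(a + b·n)(a − b·n) = a² + b²` for a pure unit `n`. [folklore] -/
theorem coe_add_smul_mul_coe_sub_smul {n : ℍ} (hn0 : n.re = 0) (hn1 : ‖n‖ = 1) (a b : ℝ) :
    ((a : ℍ) + b • n) * ((a : ℍ) - b • n) = ((a ^ 2 + b ^ 2 : ℝ) : ℍ) := by
  have hns : n.imI ^ 2 + n.imJ ^ 2 + n.imK ^ 2 = 1 := by
    have := sq_norm_eq_sum_sq n; rw [hn1, hn0] at this; nlinarith [this]
  rw [show ((a ^ 2 + b ^ 2 : ℝ) : ℍ) = ⟨a ^ 2 + b ^ 2, 0, 0, 0⟩ from rfl]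
  ext <;> simp [hn0] <;> first | linear_combination b ^ 2 * hns | ring

/-- ★ **Azimuth normal form.**  For a pure unit `n` and a unit `w` with `‖w − 1‖ ≤ 1/4` there is a unit `κ₂` commuting with `n` (a half-angle
rotation in the torus `T_n`), with `‖κ₂ − 1‖ ≤ 4‖w − 1‖`, such that `κ₂ w κ₂` has NO `n`-component and real part `≥ Re w`
(explicitly `κ₂ w κ₂ = √(w₀² + w_n²) + w_⊥` for `w = w₀ + w_n n + w_⊥`). [folklore] -/
theorem conj_azimuth_normalForm {n w : ℍ} (hn0 : n.re = 0) (hn1 : ‖n‖ = 1) (hw : ‖w‖ = 1) (hw1 : ‖w - 1‖ ≤ 1 / 4) :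
    ∃ κ : ℍ, ‖κ‖ = 1 ∧ κ * n = n * κ ∧ ⟪κ * w * κ, n⟫ = 0 ∧ w.re ≤ (κ * w * κ).re ∧ ‖κ - 1‖ ≤ 4 * ‖w - 1‖ := by
  set w₀ : ℝ := w.re with hw₀
  set wn : ℝ := ⟪w, n⟫ with hwn
  set wp : ℍ := w.im - wn • n with hwp
  have h1n : ⟪(1 : ℍ), n⟫ = 0 := by rw [Quaternion.inner_def, one_mul, Quaternion.re_star, hn0]
  have hnn1 : ⟪n, n⟫ = 1 := by rw [real_inner_self_eq_norm_sq, hn1, one_pow]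
  -- sizes
  have hw₀ge : 31 / 32 ≤ w₀ := by
    have := one_sub_re_eq hw; nlinarith [norm_nonneg (w - 1)]
  have hw₀pos : 0 < w₀ := by linarith
  have hwnle : |wn| ≤ ‖w - 1‖ := by
    have := abs_inner_le_norm_sub_one_mul (w := w) hn0; rwa [hn1, mul_one] at this
  set s : ℝ := Real.sqrt (w₀ ^ 2 + wn ^ 2) with hs
  have hs2 : s ^ 2 = w₀ ^ 2 + wn ^ 2 := Real.sq_sqrt (by positivity)
  have hsw₀ : w₀ ≤ s := by
    calc w₀ = Real.sqrt (w₀ ^ 2) := (Real.sqrt_sq hw₀pos.le).symm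
      _ ≤ s := Real.sqrt_le_sqrt (by nlinarith)
  have hspos : 0 < s := lt_of_lt_of_le hw₀pos hsw₀
  have hsup : s ≤ w₀ + |wn| := by
    calc s ≤ Real.sqrt ((w₀ + |wn|) ^ 2) := Real.sqrt_le_sqrt (by nlinarith [abs_nonneg wn, sq_abs wn])
      _ = w₀ + |wn| := Real.sqrt_sq (by positivity)
  -- the decomposition of `w`
  have hwp0 : wp.re = 0 := by simp [hwp, hn0]
  have hwpn : ⟪wp, n⟫ = 0 := by
    have : ⟪w.im, n⟫ = wn := by
      have e : w.im = w - (w.re : ℍ) := (Quaternion.sub_re_self w).symm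
      rw [hwn, e, inner_sub_left, show ((w.re : ℝ) : ℍ) = w.re • (1 : ℍ) by rw [Algebra.smul_def, mul_one]; rfl,
        real_inner_smul_left, h1n, mul_zero, sub_zero]
    rw [hwp, inner_sub_left, real_inner_smul_left, this, hnn1, mul_one, sub_self]
  have hwdec : w = ((w₀ : ℍ) + wn • n) + wp := by
    rw [hwp, hw₀, add_add_sub_cancel, Quaternion.re_add_im]
  -- the torus element `g` and its half-angle root `κ`
  set g : ℍ := s⁻¹ • ((w₀ : ℍ) - wn • n) with hg
  have hn2 : ‖(w₀ : ℍ) - wn • n‖ = s := by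
    have e : (w₀ : ℍ) - wn • n = (w₀ : ℍ) + (-wn) • n := by rw [neg_smul, sub_eq_add_neg]
    rw [e, ← Real.sqrt_sq (norm_nonneg _), norm_coe_add_smul_pure_sq hn0 hn1, neg_sq, hs]
  have hg1 : ‖g‖ = 1 := by
    rw [hg, norm_smul, norm_inv, Real.norm_eq_abs, abs_of_pos hspos, hn2, inv_mul_cancel₀ hspos.ne']
  have hgn : g * n = n * g := by
    have hnn : n * n = -1 := mul_self_of_re_eq_zero hn0 hn1
    rw [hg, smul_mul_assoc, mul_smul_comm, sub_mul, mul_sub, smul_mul_assoc, mul_smul_comm, Quaternion.coe_commutes]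
  have hg_sub : ‖g - 1‖ ≤ 2 * ‖w - 1‖ := by
    have e : g - 1 = s⁻¹ • (((w₀ - s : ℝ) : ℍ) + (-wn) • n) := by
      have h1 : s⁻¹ • ((s : ℝ) : ℍ) = 1 := by
        rw [← Quaternion.coe_smul, smul_eq_mul, inv_mul_cancel₀ hspos.ne', Quaternion.coe_one]
      rw [hg]
      conv_lhs => rw [← h1]
      rw [← smul_sub, Quaternion.coe_sub, neg_smul]
      congr 1
      abel
    rw [e, norm_smul, norm_inv, Real.norm_eq_abs, abs_of_pos hspos]
    have hn3 : ‖((w₀ - s : ℝ) : ℍ) + (-wn) • n‖ ^ 2 = (w₀ - s) ^ 2 + wn ^ 2 := by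
      rw [norm_coe_add_smul_pure_sq hn0 hn1, neg_sq]
    have hle1 : (w₀ - s) ^ 2 ≤ wn ^ 2 := by nlinarith [abs_nonneg wn, sq_abs wn]
    have hle2 : ‖((w₀ - s : ℝ) : ℍ) + (-wn) • n‖ ≤ 3 / 2 * |wn| := by
      have h0 : 0 ≤ 3 / 2 * |wn| := by positivity
      refine (pow_le_pow_iff_left₀ (norm_nonneg _) h0 two_ne_zero).mp ?_
      rw [hn3]; nlinarith [sq_abs wn]
    calc s⁻¹ * ‖((w₀ - s : ℝ) : ℍ) + (-wn) • n‖ ≤ s⁻¹ * (3 / 2 * |wn|) :=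
          mul_le_mul_of_nonneg_left hle2 (inv_nonneg.mpr hspos.le)
      _ ≤ (31 / 32)⁻¹ * (3 / 2 * |wn|) := by
          refine mul_le_mul_of_nonneg_right ?_ (by positivity)
          exact (inv_le_inv₀ hspos (by norm_num)).mpr (hw₀ge.trans hsw₀)
      _ ≤ 2 * ‖w - 1‖ := by nlinarith [abs_nonneg wn]
  have hg_sub1 : ‖g - 1‖ < 1 := by linarith
  obtain ⟨hκ1, hκsq, hκd⟩ := halfAngle_sq hg1 hg_sub1
  generalize hκdef : (‖1 + g‖⁻¹ • (1 + g) : ℍ) = κ at hκ1 hκsq hκd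
  have hκn : κ * n = n * κ := by
    rw [← hκdef, smul_mul_assoc, mul_smul_comm, add_mul, mul_add, one_mul, mul_one, hgn]
  -- `κ w κ = s + w_⊥`
  have hκwp : κ * wp = wp * star κ := mul_perp_eq_perp_mul_star hn0 hn1 hκn hwp0 hwpn
  have hcomm : κ * ((w₀ : ℍ) + wn • n) = ((w₀ : ℍ) + wn • n) * κ := by
    rw [mul_add, add_mul, mul_smul_comm, smul_mul_assoc, hκn, ← Quaternion.coe_commutes]
  have hprod : ((w₀ : ℍ) + wn • n) * g = (s : ℍ) := by
    rw [hg, mul_smul_comm, coe_add_smul_mul_coe_sub_smul hn0 hn1, ← hs2, ← Quaternion.coe_smul, smul_eq_mul, sq,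
      inv_mul_cancel_left₀ hspos.ne']
  have hfinal : κ * w * κ = (s : ℍ) + wp := by
    calc κ * w * κ = κ * (((w₀ : ℍ) + wn • n) + wp) * κ := by rw [← hwdec]
      _ = κ * ((w₀ : ℍ) + wn • n) * κ + κ * wp * κ := by noncomm_ring
      _ = ((w₀ : ℍ) + wn • n) * (κ * κ) + wp * (star κ * κ) := by rw [hcomm, hκwp]; noncomm_ring
      _ = (s : ℍ) + wp := by rw [hκsq, hprod, star_mul_self_of_norm_eq_one hκ1, mul_one]
  refine ⟨κ, hκ1, hκn, ?_, ?_, by linarith [hκd, hg_sub]⟩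
  · rw [hfinal, inner_add_left, hwpn, add_zero, show ((s : ℝ) : ℍ) = s • (1 : ℍ) by rw [Algebra.smul_def, mul_one]; rfl,
      real_inner_smul_left, h1n, mul_zero]
  · rw [hfinal, Quaternion.re_add, Quaternion.re_coe, hwp0, add_zero]; exact hsw₀


end Summit.QuantumFields.YangMills.Theorems.VirialFluxGap.AnchorSlice
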